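import Mathlib
import HarnessLib
import Summits.NavierStokesRegularity.NavierStokesRegularity.Theorems.QuarterLogPincerSilencingCostDefs
import Summits.NavierStokesRegularity.NavierStokesRegularity.Theorems.QuarterLogPincerSilencingCostEmberReadout
import Summits.NavierStokesRegularity.NavierStokesRegularity.Theorems.QuarterLogPincerSilencingCostVorticityInequality
import Summits.NavierStokesRegularity.NavierStokesRegularity.Theorems.QuarterLogPincerTypeIQuantSubcubicExpFrameTools
import Summits.NavierStokesRegularity.NavierStokesRegularity.Theorems.QuarterLogPincerTypeIQuantSubcubicExpStubUniformScaledEnergy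

/-!
# Route `QuarterLogPincer`, crux `TypeIQuantSubcubicExp` (stmt-NavierStokesRegularity-24077), line `silencing_cost` —
# the line's PROVED KERNEL by name, and Sd / Sv BY NAME

VERBATIM port (bodies byte-identical up to the unfolding of `E3`) of the sorry-free kernel of §S of
`Cruxes/TypeIQuantSubcubicExp/Lines/silencing_cost.lean` (v1.1): `enstrophyPersistence_of_thickBox : VorticityInequality →
ThickBoxSilencingCost → EnstrophyPersistence` (P1 glue) and `terminalEmber_of_stubs : RegularAftermath → VorticalCentre →
EnstrophyPersistence → EmberReadout → TerminalEmber` (S.K, with the tree's proved I1 `ThinCascade.stub_uniformScaledEnergy`),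
over the landed objects; plus the BY-NAME closures of the two stubs this seat proved in statement-shape:
`stub_emberReadout : EmberReadout := emberReadout` (Sd, p705884) and `stub_vorticityInequality : VorticityInequality :=
vorticityInequality` (Sv, p706103), and the corollary `enstrophyPersistence_of_thickBoxSilencingCost : ThickBoxSilencingCost →
EnstrophyPersistence` (Sc ⟸ Sc′ alone, Sv discharged).  The remaining stubs (Sa, Sb, Sc′) and their pluggings are NOT ported.
HONEST FRAME: implications between Props about HYPOTHETICAL Type-I classical solutions; Sa/Sb/Sc′ OPEN; nothing here bears on
24077's truth, W7 or Navier–Stokes regularity (OPEN / not proved).  pub-ns-dss typer (g38),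
`--supports stmt-NavierStokesRegularity-24077`; kernel bodies by ns-idea-7 (g12).
-/

set_option linter.dupNamespace false

namespace Summit.NavierStokesRegularity.NavierStokesRegularity.Cruxes.TypeIQuantSubcubicExp.SilencingCost

noncomputable section

open MeasureTheory Set Function Filter Topology Metric
open scoped ENNReal NNReal Classical Laplacian RealInnerProductSpace
open Literature.Analysis Literature.Analysis.FluidPDE
open Summit.NavierStokesRegularity.NavierStokesRegularity.Theorems.ThinCascade
open Summit.NavierStokesRegularity.NavierStokesRegularity.Cruxes.TypeIQuantSubcubicExp.EmberCensus (Hot Terminal TerminalEmber)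
open Summit.NavierStokesRegularity.NavierStokesRegularity.Cruxes.TypeIQuantSubcubicExp.LimitSilence (ThickBoxSilencingCost)

/-- **Sd BY NAME**: the stub `stub_emberReadout` of `silencing_cost` is the tree theorem `emberReadout`
(`…SilencingCostEmberReadout`, statement-shape), by unfolding `EmberReadout`. -/
theorem stub_emberReadout : EmberReadout := emberReadout

/-- **Sv BY NAME**: the stub `stub_vorticityInequality` of `silencing_cost` is the tree theorem `vorticityInequality`
(`…SilencingCostVorticityInequality`, statement-shape, `BoxBound` unfolded), by unfolding. -/
theorem stub_vorticityInequality : VorticityInequality := vorticityInequality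

/-- KERNEL (P1 glue): the NS-free silencing cost Sc′ and the vorticity bridge Sv give Sc `EnstrophyPersistence`.
(A prover may instead close `EnstrophyPersistence` DIRECTLY by the soft route in its docstring — compactness +
backward uniqueness — which is available for the Navier–Stokes-structured statement but not for Sc′.) -/
theorem enstrophyPersistence_of_thickBox (hV : VorticityInequality) (hS : ThickBoxSilencingCost) :
    EnstrophyPersistence := by
  intro M₁ δ Γ₂ hM₁ hδ hΓ₂
  obtain ⟨B, hB, hV⟩ := hV M₁ hM₁
  obtain ⟨K, c, hK, hc, hcδ, hS⟩ := hS B δ Γ₂ hB hδ hΓ₂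
  refine ⟨K, c, hK, hc, ?_⟩
  intro T u p hsol y σ t t₁ hσ ht0 htt₁ ht₁T hspan hbox hinit
  rcases eq_or_lt_of_le htt₁ with heq | hlt
  · subst heq
    calc ENNReal.ofReal (c / σ) ≤ ENNReal.ofReal (δ / σ) :=
          ENNReal.ofReal_le_ofReal (div_le_div_of_nonneg_right hcδ hσ.le)
      _ ≤ ∫⁻ x in ball y (Γ₂ * σ), ‖curl (u t) x‖ₑ ^ 2 := hinit
      _ ≤ ∫⁻ x in ball y (K * σ), ‖curl (u t) x‖ₑ ^ 2 :=
          lintegral_mono_set (ball_subset_ball (mul_le_mul_of_nonneg_right hK hσ.le))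
  · obtain ⟨hsm, hbd⟩ := hV T u p hsol y σ (2 * K * σ) t t₁ hσ ht0 hlt ht₁T hbox
    exact hS (fun s => curl (u s)) y σ t t₁ hσ hlt hspan hsm hbd hinit

/-- **S.K KERNEL** (`silencing_cost` v1.1, body verbatim; a docstring is added here): `RegularAftermath → VorticalCentre →
EnstrophyPersistence → EmberReadout → TerminalEmber`, with the tree's proved I1 `ThinCascade.stub_uniformScaledEnergy` feeding Sb's
energy hypothesis on the frame restricted to `[0,t]`; E2's room factor is `Λ := Γ₂²`, its aperture `2K`, its deposit `c'`. -/
theorem terminalEmber_of_stubs (hA : RegularAftermath) (hB : VorticalCentre)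
    (hC : EnstrophyPersistence) (hD : EmberReadout) : TerminalEmber := by
  obtain ⟨ε₀, hε₀, hA⟩ := hA
  refine ⟨ε₀, hε₀, fun ε M hε hεle hM => ?_⟩
  obtain ⟨M₁, hM₁, hA⟩ := hA ε M hε hεle hM
  obtain ⟨C₀, hI⟩ :=
    Summit.NavierStokesRegularity.NavierStokesRegularity.Cruxes.TypeIQuantSubcubicExp.ThinCascade.stub_uniformScaledEnergy
      M
  obtain ⟨Γ₂, δ, hΓ₂, hδ, hB⟩ := hB ε M₁ C₀ hε hM₁
  obtain ⟨K, c, hK, hc, hC⟩ := hC M₁ δ Γ₂ hM₁ hδ hΓ₂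
  have hK1 : 1 ≤ K := le_trans hΓ₂ hK
  obtain ⟨c', hc', hD⟩ := hD K M₁ c hK1 hM₁ hc
  refine ⟨2 * K, c', Γ₂ ^ 2, by linarith, hc', by nlinarith, ?_⟩
  intro T τ u p hframe hτ htypeI t₁ y t ht₁ htt₁ hroom hhot hterm
  -- positivity of the clock and of the hot time
  have hTt : 0 < T + τ - t := by linarith [ht₁.2]
  have ht0 : 0 < t := by have h := hhot.1; linarith
  have htT : t ≤ T := le_trans htt₁ ht₁.2
  have htI : t ∈ Icc 0 T := ⟨ht0.le, htT⟩
  have ht₁I : t₁ ∈ Icc 0 T := ⟨ht₁.1.le, ht₁.2⟩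
  have hσpos : 0 < Real.sqrt (T + τ - t) := Real.sqrt_pos.2 hTt
  have hσsq : Real.sqrt (T + τ - t) ^ 2 = T + τ - t := Real.sq_sqrt hTt.le
  have hhot2 : ε < Real.sqrt (T + τ - t) * ‖u t y‖ := hhot.2
  -- (a) the regular box of aperture `2K`
  have hbox4 := hA (2 * K) (by linarith) T τ u p hframe hτ htypeI t₁ y t ht₁ htt₁ hhot hterm
  generalize hσdef : Real.sqrt (T + τ - t) = σ at hσpos hσsq hhot2 hbox4 ⊢
  have hKσ : 0 < K * σ := mul_pos (by linarith) hσpos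
  have hbox : BoxBound M₁ σ u y (Icc t t₁) (2 * K * σ) := boxBound_mono hbox4 (by nlinarith)
  -- (b) I1 on the frame restricted to `[0,t]` gives the slice energy at radius `Γ₂σ`, then Sb
  have hframe_t := frame_restrict hframe ht0 htT
  have hτ' : 0 < T - t + τ := by linarith
  have hrate_t := typeI_restrict htypeI htT
  have hΓσ : 0 < Γ₂ * σ := mul_pos (by linarith) hσpos
  have hΓσ2 : (Γ₂ * σ) ^ 2 ≤ t := by
    have e : (Γ₂ * σ) ^ 2 = Γ₂ ^ 2 * (T + τ - t) := by rw [mul_pow, hσsq]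
    rw [e]; exact hroom
  have hI1 := (hI t (T - t + τ) u p hframe_t hτ' hrate_t y (Γ₂ * σ) hΓσ hΓσ2).1 t
    ⟨by nlinarith [sq_nonneg (Γ₂ * σ)], le_rfl⟩
  have hv2 : ContDiff ℝ 2 (u t) := (hframe.1.contDiff_velocity htI).of_le (WithTop.coe_le_coe.2 le_top)
  have hgrad : ∀ x ∈ ball y σ, ∀ j : ℕ, j ≤ 2 →
      ‖iteratedFDeriv ℝ j (u t) x‖ ≤ M₁ * σ ^ (-((j : ℝ) + 1)) :=
    fun x hx j hj => hbox t ⟨le_rfl, htt₁⟩ x (ball_subset_ball (by nlinarith) hx) j hj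
  have hvort := hB (u t) y σ hσpos hv2 (hframe.1.divFree t htI) hgrad hI1 hhot2
  -- (c) the linear lemma from `t` to `t₁`
  have hspan : t₁ ≤ t + σ ^ 2 := by rw [hσsq]; linarith [ht₁.2]
  have hpers := hC T u p hframe.1 y σ t t₁ hσpos ht0.le htt₁ ht₁.2 hspan hbox hvort
  -- (d) readout at `t₁`
  have hv2' : ContDiff ℝ 2 (u t₁) :=
    (hframe.1.contDiff_velocity ht₁I).of_le (WithTop.coe_le_coe.2 le_top)
  exact hD (u t₁) y σ hσpos hv2' (fun x hx j hj => hbox t₁ ⟨htt₁, le_rfl⟩ x hx j hj) hpers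

/-- Sc `EnstrophyPersistence` from Sc′ `ThickBoxSilencingCost` ALONE (the vorticity bridge Sv is the tree theorem
`stub_vorticityInequality`). -/
theorem enstrophyPersistence_of_thickBoxSilencingCost (hS : ThickBoxSilencingCost) : EnstrophyPersistence :=
  enstrophyPersistence_of_thickBox stub_vorticityInequality hS

/-- E2 `TerminalEmber` modulo Sa, Sb and Sc′ only (Sv, Sd discharged by name). -/
theorem terminalEmber_of_aftermath_of_vortical_of_thickBox (hA : RegularAftermath) (hB : VorticalCentre)
    (hS : ThickBoxSilencingCost) : TerminalEmber :=
  terminalEmber_of_stubs hA hB (enstrophyPersistence_of_thickBoxSilencingCost hS) stub_emberReadout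


end

end Summit.NavierStokesRegularity.NavierStokesRegularity.Cruxes.TypeIQuantSubcubicExp.SilencingCost
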